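import Literature.Analysis.FluidPDE.PressurePoisson
import Mathlib.Analysis.Calculus.MeanValue
import HarnessLib

/-!
# StrainClockRigid — door family S38 «StrainClockDoors» (nsreg-p1 ROUND-36), plate «RigidMotion» (pre-typed core)

S-door lane (ns-sfl-p1 g5; LEAD ns-s30-p1 g3; plan of record nsreg-p1 g32 2026-08-28T19:30:08Z, texts pending —
TEXT-INDEPENDENT core; `--supports stmt-NavierStokesRegularity-0056 --as helper`). The calculus fact behind the
rate-free door (A1) «strain-starved bounded ancient solutions are constant»: **a `C²` vector field on `ℝ³` (any
finite-dimensional real inner product space) whose STRAIN FORM vanishes identically, `⟪∇v(x)e, e⟫ = 0` for all `x, e`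
(i.e. `S ≡ 0`, `∇v` antisymmetric — a Killing field of Euclidean space), is AFFINE with antisymmetric linear part,
`v(x) = v(0) + ∇v(0)x`; if moreover `v` is bounded, it is CONSTANT.** Proof: polarisation gives
`⟪∇v a, b⟫ = −⟪∇v b, a⟫`; differentiating, `T(a,b,c) = ⟪D²v(x)(a)(b), c⟫` is symmetric in `(a,b)` (Schwarz) and
antisymmetric in `(b,c)`, hence zero (the classical braid `T(a,b,c) = −T(a,c,b) = −T(c,a,b) = T(c,b,a) = T(b,c,a) =
−T(b,a,c) = −T(a,b,c)`); so `D²v ≡ 0`, `∇v` is constant, `v` is affine; a bounded affine map has zero linear part.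

WHAT THIS IS NOT: calculus serving a CONDITIONAL Liouville-type criterion (door family S38); item 0056 `NoTypeII`, the
Liouville conjecture 10661 and NS regularity are NOT proved; nothing here is a route or a summit statement.
-/

-- the summit's problem namespace repeats the summit name (tree layout)
set_option linter.dupNamespace false

noncomputable section

open Set Function InnerProductSpace
open scoped RealInnerProductSpace ContDiff
open Literature.Analysis Literature.Analysis.FluidPDE

namespace Summit.NavierStokesRegularity.NavierStokesRegularity.Theorems.ArgmaxDoors

variable {E : Type*} [NormedAddCommGroup E] [InnerProductSpace ℝ E]

-- nested operator types (second derivatives)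
set_option maxSynthPendingDepth 3

/-- Polarisation: if the strain form of `A` vanishes (`⟪Ae, e⟫ = 0` for all `e`) then `A` is antisymmetric. -/
theorem inner_apply_eq_neg_of_inner_apply_self_eq_zero (A : E →L[ℝ] E) (hA : ∀ e, ⟪A e, e⟫ = 0) (a b : E) :
    ⟪A a, b⟫ = -⟪A b, a⟫ := by
  have h := hA (a + b)
  rw [map_add, inner_add_left, inner_add_right, inner_add_right, hA a, hA b] at h
  linarith

/-- **Killing fields of Euclidean space have vanishing second derivative**: if `v ∈ C²` and `⟪∇v(x)e, e⟫ = 0` for all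
`x, e`, then `D²v(x) = 0` for every `x`. -/
theorem fderiv_fderiv_eq_zero_of_strain_eq_zero {v : E → E} (hv : ContDiff ℝ 2 v)
    (hS : ∀ x e, ⟪fderiv ℝ v x e, e⟫ = 0) (x : E) : fderiv ℝ (fderiv ℝ v) x = 0 := by
  have hD1 : ContDiff ℝ 1 (fderiv ℝ v) := hv.fderiv_right (m := 1) (by norm_cast)
  have hD1d : Differentiable ℝ (fderiv ℝ v) := hD1.differentiable one_ne_zero
  -- `T(a,b,c) = ⟪D²v(x)(a)(b), c⟫`
  -- symmetric in `(a, b)` (Schwarz)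
  have hsym : ∀ a b c : E, ⟪fderiv ℝ (fderiv ℝ v) x a b, c⟫ = ⟪fderiv ℝ (fderiv ℝ v) x b a, c⟫ := by
    intro a b c
    rw [(hv.contDiffAt.isSymmSndFDerivAt (by simp [minSmoothness_of_isRCLikeNormedField])).eq a b]
  -- antisymmetric in `(b, c)`: differentiate `y ↦ ⟪∇v(y) b, c⟫ + ⟪∇v(y) c, b⟫ ≡ 0` in the direction `a`
  have hanti : ∀ a b c : E, ⟪fderiv ℝ (fderiv ℝ v) x a b, c⟫ = -⟪fderiv ℝ (fderiv ℝ v) x a c, b⟫ := by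
    intro a b c
    have hconst : ((fun y => ⟪fderiv ℝ v y b, c⟫) + fun y => ⟪fderiv ℝ v y c, b⟫) = fun _ => (0 : ℝ) := by
      funext y
      simp only [Pi.add_apply]
      rw [inner_apply_eq_neg_of_inner_apply_self_eq_zero (fderiv ℝ v y) (hS y) b c]
      ring
    have hgb : DifferentiableAt ℝ (fun y => fderiv ℝ v y b) x := (hD1d x).clm_apply (differentiableAt_const b)
    have hgc : DifferentiableAt ℝ (fun y => fderiv ℝ v y c) x := (hD1d x).clm_apply (differentiableAt_const c)
    have h1 : HasFDerivAt (fun y => ⟪fderiv ℝ v y b, c⟫)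
        ((innerSL ℝ c).comp (fderiv ℝ (fun y => fderiv ℝ v y b) x)) x := by
      have h := (innerSL ℝ c).hasFDerivAt.comp x hgb.hasFDerivAt
      have hfun : (fun y => ⟪fderiv ℝ v y b, c⟫) = (innerSL ℝ c) ∘ (fun y => fderiv ℝ v y b) := by
        funext y; simp only [comp_apply, innerSL_apply_apply]; exact real_inner_comm _ _
      rw [hfun]; exact h
    have h2 : HasFDerivAt (fun y => ⟪fderiv ℝ v y c, b⟫)
        ((innerSL ℝ b).comp (fderiv ℝ (fun y => fderiv ℝ v y c) x)) x := by
      have h := (innerSL ℝ b).hasFDerivAt.comp x hgc.hasFDerivAt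
      have hfun : (fun y => ⟪fderiv ℝ v y c, b⟫) = (innerSL ℝ b) ∘ (fun y => fderiv ℝ v y c) := by
        funext y; simp only [comp_apply, innerSL_apply_apply]; exact real_inner_comm _ _
      rw [hfun]; exact h
    have hsum := h1.add h2
    rw [hconst] at hsum
    have h0 := hsum.unique (hasFDerivAt_const (0 : ℝ) x)
    have h0a := congrArg (fun L : E →L[ℝ] ℝ => L a) h0
    simp only [add_apply, ContinuousLinearMap.coe_comp, comp_apply, innerSL_apply_apply, zero_apply] at h0a
    rw [fderiv_apply_const_apply (hD1d x) b a, fderiv_apply_const_apply (hD1d x) c a] at h0a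
    linarith [h0a, real_inner_comm (fderiv ℝ (fderiv ℝ v) x a b) c, real_inner_comm (fderiv ℝ (fderiv ℝ v) x a c) b]
  -- the braid: `T(a,b,c) = 0`
  have hzero : ∀ a b c : E, ⟪fderiv ℝ (fderiv ℝ v) x a b, c⟫ = 0 := by
    intro a b c
    have e1 := hanti a b c      -- T(a,b,c) = −T(a,c,b)
    have e2 := hsym a c b       -- T(a,c,b) = T(c,a,b)
    have e3 := hanti c a b      -- T(c,a,b) = −T(c,b,a)
    have e4 := hsym c b a       -- T(c,b,a) = T(b,c,a)
    have e5 := hanti b c a      -- T(b,c,a) = −T(b,a,c)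
    have e6 := hsym b a c       -- T(b,a,c) = T(a,b,c)
    linarith
  ext a b
  have h := hzero a b (fderiv ℝ (fderiv ℝ v) x a b)
  rw [real_inner_self_eq_norm_sq, sq_eq_zero_iff, norm_eq_zero] at h
  rw [h]
  rfl

/-- **A strain-free `C²` field is affine**: `v(x) = v(0) + ∇v(0) x`. -/
theorem eq_add_fderiv_apply_of_strain_eq_zero {v : E → E} (hv : ContDiff ℝ 2 v)
    (hS : ∀ x e, ⟪fderiv ℝ v x e, e⟫ = 0) (x : E) : v x = v 0 + fderiv ℝ v 0 x := by
  have hvd : Differentiable ℝ v := hv.differentiable (by norm_num)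
  have hD1 : ContDiff ℝ 1 (fderiv ℝ v) := hv.fderiv_right (m := 1) (by norm_cast)
  have hD1d : Differentiable ℝ (fderiv ℝ v) := hD1.differentiable one_ne_zero
  -- `∇v` is constant
  have hDconst : ∀ y, fderiv ℝ v y = fderiv ℝ v 0 := fun y =>
    is_const_of_fderiv_eq_zero hD1d (fun z => fderiv_fderiv_eq_zero_of_strain_eq_zero hv hS z) y 0
  -- `g = v − ∇v(0)` has zero derivative
  have hg : ∀ y, fderiv ℝ (fun z => v z - fderiv ℝ v 0 z) y = 0 := by
    intro y
    rw [fderiv_fun_sub (hvd y) ((fderiv ℝ v 0).differentiableAt), ContinuousLinearMap.fderiv, hDconst y, sub_self]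
  have hgd : Differentiable ℝ (fun z => v z - fderiv ℝ v 0 z) := hvd.sub (fderiv ℝ v 0).differentiable
  have h := is_const_of_fderiv_eq_zero hgd hg x 0
  simp only [map_zero, sub_zero] at h
  rw [← h, sub_add_cancel]

/-- **Plate «RigidMotion» core**: a BOUNDED `C²` vector field on a real inner product space whose strain form vanishes
identically (`⟪∇v(x)e, e⟫ = 0` for all `x, e`) is CONSTANT. -/
theorem eq_of_strain_eq_zero_of_bounded {v : E → E} (hv : ContDiff ℝ 2 v)
    (hS : ∀ x e, ⟪fderiv ℝ v x e, e⟫ = 0) {U : ℝ} (hU : ∀ x, ‖v x‖ ≤ U) (x : E) : v x = v 0 := by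
  have haff := eq_add_fderiv_apply_of_strain_eq_zero hv hS
  -- the linear part vanishes: `‖t • A e‖ ≤ 2U` for all `t`
  have hA : ∀ e, fderiv ℝ v 0 e = 0 := by
    intro e
    by_contra hne
    have hpos : 0 < ‖fderiv ℝ v 0 e‖ := norm_pos_iff.2 hne
    have hU0 : 0 ≤ U := (norm_nonneg _).trans (hU 0)
    -- evaluate at `t • e`, `t = (2U + 1)/‖A e‖`
    have key : ∀ t : ℝ, |t| * ‖fderiv ℝ v 0 e‖ ≤ 2 * U := by
      intro t
      have h1 := haff (t • e)
      rw [map_smul] at h1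
      have h2 : t • fderiv ℝ v 0 e = v (t • e) - v 0 := by rw [h1]; abel
      calc |t| * ‖fderiv ℝ v 0 e‖ = ‖t • fderiv ℝ v 0 e‖ := by rw [norm_smul, Real.norm_eq_abs]
        _ = ‖v (t • e) - v 0‖ := by rw [h2]
        _ ≤ ‖v (t • e)‖ + ‖v 0‖ := norm_sub_le _ _
        _ ≤ U + U := add_le_add (hU _) (hU _)
        _ = 2 * U := by ring
    have h3 := key ((2 * U + 1) / ‖fderiv ℝ v 0 e‖)
    rw [abs_of_pos (by positivity), div_mul_cancel₀ _ hpos.ne'] at h3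
    linarith
  rw [haff x, hA x, add_zero]

end Summit.NavierStokesRegularity.NavierStokesRegularity.Theorems.ArgmaxDoors

end
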